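/-
Copyright (c) 2026 the pub-hodgecm-mathlib formalisation cell (harness21).  Prover seat hodgecm-mathlib-LH4-p04 (g4), req620 Track A «(D-RAM) FOUR-FRAME» squad
(unit U2H_HSide, the (ρ2b′-X) payer road; payer LH4-p14 (g4) hand (C4) «T5s-RamK ∕ RamM» 05:05:59Z; letters of record = F0P3-p01 (g32) T5b «TORIC LEVEL CENSUS, TYPE RamK»
sheet v4 §2 ∕ §2b ∕ §7 + ★ p857459 `QuadraticOrderNormDepthIndexRamK` ∕ ★ p857489 `F0P3cDyRamToricLevelCensusRamK`; dealer∕pen LH4-plan (g12); heir LEAD F0P3a-plan (g20) T19-05 (1)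
«class-keyed level letter: RK `2n_H = jλ − d`»).  2026-09-04.
-/
import Summits.HodgeConjecture.HodgeConjecture.Theorems.F0P3cDyRamToricCensusSumUnrBlocks   -- ★ p857321 (LH4-p04 (g3)): parity-ray ∕ window re-indexing, `geom_sum_mul'`, `geom_sum_two_mul`
import Mathlib.Algebra.Ring.GeomSum
import HarnessLib

/-!
# Crux `H413`, line LH4 «(D-RAM) FOUR-FRAME» road — unit U2H (ii-H), the (ρ2b′-X) payer: O-Sum ∕ T5s «TORIC CENSUS SUM», TYPE RamK («K∕F RAMIFIED, K♮∕F UNRAMIFIED») —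
# FILE 1∕2 «PARTS»: the difference of the two u-free RamK tables, the cells and the columns of the difference census, the two geometric blocks

Cell `hodgecm-mathlib` (D-0151), FLOOR 0, crux item H413 = `stmt-HodgeConjecture-24833`, route of record `HCCMUnconditional`; squad F0∕P3c∕LH4 (req618∕req620); registered stub
served: `F0P3cDyRamFourFrameU2H.stub_U2H_fixedPointCensus_typeTwo_unit0` ((ρ2b′-X), tree `Cruxes/H413/Lines/F0_P3c_DyRamFourFrame_U2H_HSide.lean` :418), organ O-Sum ∕ T5s
(payer lineage LH4-p14, HEAD-OF-ORGANS MAP v1 seam S7 «RK∕RM twins»), type RamK = `K∕F` ramified with the third field `K♮` unramified (so `M∕E` unramified, `M∕K♮` ramified with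
the datum `(d, t)` of `E∕F`, `M∕K` unramified).  THEOREMS ONLY (no `def`, no instance, no notation, no `sorry`, default heartbeats); lane `--supports stmt-HodgeConjecture-24833 --as helper`
(count-neutral).  Pure finite-sum bookkeeping over `ℚ` — no lattices, no fields.

LETTERS (all hypotheses of FILE 2's head are instantiated from these shapes).  The u-FREE TABLES are F0P3-p01 (g32)'s sheet-v4 sentences `ncard_levelSet_ramK_hyper ∕ _aniso`
(ℕ-valued `if-then-else` in `(q, d, j, a)`, cast to `ℚ`; `c := j − a` the ρ-depth, only `a ≡ j (2)`): hyperbolic `n₊(j,a)` = `q^j` (`a = j`), `δ(j)q^{j∕2}` (`a = 0`, `δ = 2` iff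
`2d ≤ j+1`), `(q−1)q^{j−1−c∕2}` (`c < 2d−2`), `(q−2)q^{j−d}` (`c = 2d−2`), `2(q−1)q^{j−1−c∕2}` (`c > 2d−2`); anisotropic `n₋(j,a)` = `q^j`, `q^{j∕2}·[j ≤ 2d−2]`, `(q−1)q^{j−1−c∕2}`,
`q^{j−d+1}`, `0`.  Their DIFFERENCE (`tables_diff_ramK`) is the group form `|G_j|·([c ≥ 2d−1]∕I(c) − [a ≥ 1][c+1 ≥ 2d−1]∕I(c+1))`: `2q^{j∕2}` on the cumulative row `a = 0`, `j ≥ 2d`;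
`−2q^{j−d}` at `c = 2d−2`; `2(q−1)q^{j−1−c∕2}` at even `c ≥ 2d`; `0` elsewhere.  The DEPTH RULES at the tokens `(m, ε)` (`|μ| = |ϖ|^m`, `μ = λ − u`, `ℓ = jl − m`): (D1)(D2)
GENERIC cells `a ≤ m ∧ (j + a ≤ m ∨ (2a ≤ m ∧ j + a ≤ jl))` are whole, the other off-diagonal cells empty (sheet v4 §2b token for token); (D3) the diagonal `j + m = jl + a` top cells
(`m < 2a`) are worth `|G_j|∕I(c′) = (1 ∣ 2)·q^{j − ⌈c′∕2⌉}`, `c′ = j + a − m` (`2` iff `c′ ≥ 2d − 1`, i.e. `¬ (j + a + 2 ≤ m + 2d)`), ALIVE iff the bit `2j + d ≤ 2jl + 1` holds (the class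
of `μ` meets `E^×·𝒪_{K♮}^×·U^{(c′)}` iff `c′ ≤ jl − d + 1`: the Φ-mechanism of LH4-p08 (g4)'s T5a v2 §5 run with `M∕K` UNRAMIFIED, `Φ(M¹_s) = K¹_{s+d−1}`, `v(λ∕ρλ − 1) = jl`; = g32 §7
(i) `j < j_λ` at d ∈ {2,3}, `j ≤ j_λ` at d = 1) and, beyond the threshold `c′ ≥ 2d − 1` where `[𝒪_{K♮}^× H_{c′} : H_{c′}] = 2`, only on the side of the norm class `ε` (g32 §7 (ii)); below
it both sides are alive and CANCEL in `v₊ − v₋`.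
CONTENT.  `tables_diff_ramK` (§2 letters ⇒ the sparse difference); `col_zero_ramK` (the column `a = 0`: `2x^d·[⌊jl∕2⌋ + 1 − d]_x`); `cell_pos_ramK` ∕ `col_pos_ramK` (a column `a ≥ 1`:
generic parity ray `j = a + 2k`, worth `2x^{⌊jl∕2⌋+a} − 2(x+1)x^{2a+d−2}` iff `2a ≤ m ∧ d + a ≤ ⌊jl∕2⌋ + 1`, plus the one-sided diagonal top cell `ε·2x^{⌊jl∕2⌋+a}` iff
`m < 2a ∧ 2a + d ≤ 2m + 1 ∧ 2m + 2d ≤ jl + 2a + 1`); `genBlock_mul` ∕ `topBlock_mul` (the two geometric blocks after one multiplication by `x − 1`).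
HONEST LABEL.  Count-neutral (`--supports`); nothing printed is asserted; (ρ2b′-X) `stub_U2H_fixedPointCensus_typeTwo_unit0` (U2H :418) stays a PROVER TARGET (an empirical
census law, kit-confirmed; (R-25): organ road measured at `tE = 2`) until its payer lands; `HC_CM` is proved only modulo the 7 printed citations (2 remaining named inputs: hLiu418 =
`stmt-HodgeConjecture-24832`, h413 = `stmt-HodgeConjecture-24833`) until rung 0 closes.

## References
* [Kottwitz1986BaseChangeUnits] R. E. Kottwitz, *Base change for unit elements of Hecke algebras*, Compositio Math. 60 (1986), §1 pp. 240–241 (orbital integrals of units as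
  lattice counts modulo the torus).
* [Rogawski1990] J. D. Rogawski, *Automorphic Representations of Unitary Groups in Three Variables*, Ann. of Math. Stud. 123 (1990), §4.9 Prop. 4.9.1 (b) p. 55, Lemma 4.9.3 p. 56
  (the fixed-point census of a type-(2) element; the toric decomposition).
* [Flicker1998UnitaryFL] Y. Z. Flicker, *Elementary proof of the fundamental lemma for a unitary group*, Canad. J. Math. 50 (1998): Prop. 7 p. 84 (the level tables).
-/

set_option autoImplicit false

namespace Summit.HodgeConjecture.HodgeConjecture.Cruxes.H413.F0P3cDyRamToricCensusSumRamKParts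

open Finset
open Summit.HodgeConjecture.HodgeConjecture.Cruxes.H413.F0P3cDyRamToricCensusSumUnrBlocks (sum_range_parity_reindex sum_range_window_reindex geom_sum_mul' geom_sum_two_mul)

/-- **THE DIFFERENCE OF THE TWO u-FREE RamK TABLES** (T5b sheet v4 §2, `d ≥ 2`, cast to `ℚ`): `n₊(j,a) − n₋(j,a)` vanishes except on the cumulative row `a = 0`, `j ≥ 2d`
(`2q^{j∕2}`) and on the even depths `c = j − a ≥ 2d − 2`, `0 < a < j` (`−2q^{j−d}` at `c = 2d−2`, `2(q−1)q^{j−1−c∕2}` beyond) — the group form `|G_j|·([c ≥ 2d−1]∕I(c) − [a ≥ 1][c+1 ≥ 2d−1]∕I(c+1))`. [folklore] -/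
theorem tables_diff_ramK (q : ℕ) (hq : 2 ≤ q) {d : ℕ} (hd : 2 ≤ d) (j a : ℕ) :
    ((if j = 0 then (if a = 0 then 1 else 0) else if j < a ∨ (j - a) % 2 = 1 then 0
      else if a = j then (if 2 ≤ d then q ^ j else (q - 1) * q ^ (j - 1)) else if a = 0 then (if 2 * d ≤ j + 1 then 2 else 1) * q ^ (j / 2)
      else if j - a + 2 < 2 * d then (q - 1) * q ^ (j - 1 - (j - a) / 2) else if j - a + 2 = 2 * d then (q - 2) * q ^ (j - d)
      else 2 * (q - 1) * q ^ (j - 1 - (j - a) / 2) : ℕ) : ℚ) -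
    ((if j = 0 then (if a = 0 then 1 else 0) else if j < a ∨ (j - a) % 2 = 1 then 0
      else if a = j then (if 2 ≤ d then q ^ j else (q + 1) * q ^ (j - 1)) else if a = 0 then (if j + 2 ≤ 2 * d then q ^ (j / 2) else 0)
      else if j - a + 2 < 2 * d then (q - 1) * q ^ (j - 1 - (j - a) / 2) else if j - a + 2 = 2 * d then q ^ (j - d + 1) else 0 : ℕ) : ℚ) =
    if a ≤ j ∧ (j - a) % 2 = 0 then
      (if a = 0 then (if 2 * d ≤ j then 2 * (q : ℚ) ^ (j / 2) else 0)
       else if a < j then (if j - a + 2 = 2 * d then -2 * (q : ℚ) ^ (j - d) else if 2 * d < j - a + 2 then 2 * ((q : ℚ) - 1) * (q : ℚ) ^ (j - 1 - (j - a) / 2) else 0)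
       else 0)
    else 0 := by
  have hq1 : ((q - 1 : ℕ) : ℚ) = (q : ℚ) - 1 := by rw [Nat.cast_sub (by omega)]; norm_num
  have hq2 : ((q - 2 : ℕ) : ℚ) = (q : ℚ) - 2 := by rw [Nat.cast_sub (by omega)]; norm_num
  rcases Nat.eq_zero_or_pos j with rfl | hj
  · -- `j = 0`
    by_cases ha : a = 0
    · subst ha; simp; omega
    · rw [if_pos rfl, if_neg ha, if_pos rfl, if_neg ha, if_neg (fun h => ha (by omega))]; simp
  have hj0 : j ≠ 0 := by omega
  rw [if_neg hj0, if_neg hj0]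
  by_cases hbad : j < a ∨ (j - a) % 2 = 1
  · rw [if_pos hbad, if_pos hbad, if_neg (fun h => by omega)]; simp
  rw [if_neg hbad, if_neg hbad, if_pos (show a ≤ j ∧ (j - a) % 2 = 0 by omega)]
  by_cases haj : a = j
  · rw [if_pos haj, if_pos haj, if_pos hd, if_pos hd, if_neg (show a ≠ 0 by omega), if_neg (show ¬ a < j by omega)]; simp
  rw [if_neg haj, if_neg haj]
  by_cases ha0 : a = 0
  · subst ha0
    rw [if_pos rfl, if_pos rfl, if_pos rfl]
    by_cases h2 : 2 * d ≤ j
    · rw [if_pos (show 2 * d ≤ j + 1 by omega), if_neg (show ¬ j + 2 ≤ 2 * d by omega), if_pos h2]; push_cast; ring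
    · rw [if_neg (show ¬ 2 * d ≤ j + 1 by omega), if_pos (show j + 2 ≤ 2 * d by omega), if_neg h2]; push_cast; ring
  rw [if_neg ha0, if_neg ha0, if_neg ha0, if_pos (show a < j by omega)]
  by_cases hlt : j - a + 2 < 2 * d
  · rw [if_pos hlt, if_pos hlt, if_neg (by omega), if_neg (by omega)]; push_cast; ring
  rw [if_neg hlt, if_neg hlt]
  by_cases heq : j - a + 2 = 2 * d
  · rw [if_pos heq, if_pos heq, if_pos heq]; push_cast; rw [hq2, pow_succ]; ring
  · rw [if_neg heq, if_neg heq, if_neg heq, if_pos (by omega)]; push_cast; rw [hq1]; ring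


/-- **THE COLUMN `a = 0`** of the RamK difference census: every cell of the column is generic (whole), and `n₊(j,0) − n₋(j,0) = 2q^{j∕2}` exactly on the even rows `j ≥ 2d`;
so the column sums to `2x^d·[⌊jl∕2⌋ + 1 − d]_x`. [folklore] -/
theorem col_zero_ramK (x : ℚ) {d jl m : ℕ} (nP nM vP vM : ℕ → ℕ → ℚ)
    (hδ : ∀ j a, nP j a - nM j a = if a ≤ j ∧ (j - a) % 2 = 0 then
      (if a = 0 then (if 2 * d ≤ j then 2 * x ^ (j / 2) else 0)
       else if a < j then (if j - a + 2 = 2 * d then -2 * x ^ (j - d) else if 2 * d < j - a + 2 then 2 * (x - 1) * x ^ (j - 1 - (j - a) / 2) else 0)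
       else 0) else 0)
    (hvGen : ∀ j a, (a ≤ m ∧ (j + a ≤ m ∨ (2 * a ≤ m ∧ j + a ≤ jl))) → vP j a = nP j a ∧ vM j a = nM j a) :
    ∑ j ∈ range (jl + 1), x ^ 0 * (vP j 0 - vM j 0) = 2 * x ^ d * ∑ k ∈ range (jl / 2 + 1 - d), x ^ k := by
  have hcell : ∀ j ∈ range (jl + 1), x ^ 0 * (vP j 0 - vM j 0) = if 2 * d ≤ j ∧ (j - 2 * d) % 2 = 0 then 2 * x ^ (j / 2) else 0 := by
    intro j hj
    rw [Finset.mem_range] at hj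
    obtain ⟨hP, hM⟩ := hvGen j 0 ⟨Nat.zero_le _, Or.inr ⟨by omega, by omega⟩⟩
    rw [pow_zero, one_mul, hP, hM, hδ, if_pos rfl]
    by_cases h : 2 * d ≤ j ∧ (j - 2 * d) % 2 = 0
    · rw [if_pos h, if_pos (show 0 ≤ j ∧ (j - 0) % 2 = 0 by omega), if_pos h.1]
    · rw [if_neg h]
      by_cases h' : 0 ≤ j ∧ (j - 0) % 2 = 0
      · rw [if_pos h', if_neg (by omega)]
      · rw [if_neg h']
  rw [Finset.sum_congr rfl hcell, sum_range_parity_reindex (fun j => 2 * x ^ (j / 2)) (2 * d) jl, Finset.mul_sum]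
  rw [show (jl + 2 - 2 * d) / 2 = jl / 2 + 1 - d by omega]
  refine Finset.sum_congr rfl fun u _ => ?_
  rw [show (2 * d + 2 * u) / 2 = d + u by omega, pow_add]; ring

/-- **ONE CELL OF A COLUMN `a ≥ 1`** of the RamK difference census `x^a·(v₊ − v₋)(j,a)`: a generic cell carries `x^a·(n₊ − n₋)(j,a)` (parity ray `j ≡ a`, `a < j`), an off-diagonal
non-generic cell nothing, and the diagonal top cell `j + m = jl + a` carries `ε·2x^{⌊jl∕2⌋+a}` exactly when it is alive on one side only (`2j + d ≤ 2jl + 1`, `c′ = j + a − m ≥ 2d − 1`). [folklore] -/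
theorem cell_pos_ramK (x ε : ℚ) (hε : ε = 1 ∨ ε = -1) {d jl m : ℕ} (hm : m ≤ jl) (nP nM vP vM : ℕ → ℕ → ℚ)
    (hδ : ∀ j a, nP j a - nM j a = if a ≤ j ∧ (j - a) % 2 = 0 then
      (if a = 0 then (if 2 * d ≤ j then 2 * x ^ (j / 2) else 0)
       else if a < j then (if j - a + 2 = 2 * d then -2 * x ^ (j - d) else if 2 * d < j - a + 2 then 2 * (x - 1) * x ^ (j - 1 - (j - a) / 2) else 0)
       else 0) else 0)
    (hvGen : ∀ j a, (a ≤ m ∧ (j + a ≤ m ∨ (2 * a ≤ m ∧ j + a ≤ jl))) → vP j a = nP j a ∧ vM j a = nM j a)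
    (hvOff : ∀ j a, ¬ (a ≤ m ∧ (j + a ≤ m ∨ (2 * a ≤ m ∧ j + a ≤ jl))) → j + m ≠ jl + a → vP j a = 0 ∧ vM j a = 0)
    (hvTop : ∀ j a, ¬ (a ≤ m ∧ (j + a ≤ m ∨ (2 * a ≤ m ∧ j + a ≤ jl))) → j + m = jl + a →
      (vP j a = if 2 * j + d ≤ 2 * jl + 1 ∧ (j + a + 2 ≤ m + 2 * d ∨ ε = 1) then (if j + a + 2 ≤ m + 2 * d then 1 else 2) * x ^ (j - (j + a - m + 1) / 2) else 0) ∧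
      (vM j a = if 2 * j + d ≤ 2 * jl + 1 ∧ (j + a + 2 ≤ m + 2 * d ∨ ε = -1) then (if j + a + 2 ≤ m + 2 * d then 1 else 2) * x ^ (j - (j + a - m + 1) / 2) else 0))
    {a : ℕ} (ha : 1 ≤ a) (j : ℕ) :
    x ^ a * (vP j a - vM j a) =
      (if a ≤ j ∧ (j - a) % 2 = 0 then
        (if (a ≤ m ∧ (j + a ≤ m ∨ (2 * a ≤ m ∧ j + a ≤ jl))) ∧ a < j then
          x ^ a * (if j - a + 2 = 2 * d then -2 * x ^ (j - d) else if 2 * d < j - a + 2 then 2 * (x - 1) * x ^ (j - 1 - (j - a) / 2) else 0)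
        else 0) else 0) +
      (if j + m = jl + a then
        ε * (if ¬ (a ≤ m ∧ (j + a ≤ m ∨ (2 * a ≤ m ∧ j + a ≤ jl))) ∧ 2 * j + d ≤ 2 * jl + 1 ∧ ¬ (j + a + 2 ≤ m + 2 * d) then 2 * x ^ (jl / 2 + a) else 0)
       else 0) := by
  have ha0 : a ≠ 0 := by omega
  by_cases hg : a ≤ m ∧ (j + a ≤ m ∨ (2 * a ≤ m ∧ j + a ≤ jl))
  · -- a generic cell: the u-free difference
    obtain ⟨hP, hM⟩ := hvGen j a hg
    have h2 : (if j + m = jl + a then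
        ε * (if ¬ (a ≤ m ∧ (j + a ≤ m ∨ (2 * a ≤ m ∧ j + a ≤ jl))) ∧ 2 * j + d ≤ 2 * jl + 1 ∧ ¬ (j + a + 2 ≤ m + 2 * d) then 2 * x ^ (jl / 2 + a) else 0)
       else 0) = 0 := by
      rw [if_neg (show ¬ (¬ (a ≤ m ∧ (j + a ≤ m ∨ (2 * a ≤ m ∧ j + a ≤ jl))) ∧ 2 * j + d ≤ 2 * jl + 1 ∧ ¬ (j + a + 2 ≤ m + 2 * d)) from fun h => h.1 hg),
        mul_zero, ite_self]
    rw [h2, add_zero, hP, hM, hδ, if_neg ha0]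
    by_cases hpar : a ≤ j ∧ (j - a) % 2 = 0
    · rw [if_pos hpar, if_pos hpar]
      by_cases hlt : a < j
      · rw [if_pos hlt, if_pos (And.intro hg hlt)]
      · rw [if_neg hlt, if_neg (show ¬ ((a ≤ m ∧ (j + a ≤ m ∨ (2 * a ≤ m ∧ j + a ≤ jl))) ∧ a < j) from fun h => hlt h.2), mul_zero]
    · rw [if_neg hpar, if_neg hpar, mul_zero]
  · have h1 : (if a ≤ j ∧ (j - a) % 2 = 0 then
        (if (a ≤ m ∧ (j + a ≤ m ∨ (2 * a ≤ m ∧ j + a ≤ jl))) ∧ a < j then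
          x ^ a * (if j - a + 2 = 2 * d then -2 * x ^ (j - d) else if 2 * d < j - a + 2 then 2 * (x - 1) * x ^ (j - 1 - (j - a) / 2) else 0)
        else 0) else 0) = 0 := by
      rw [if_neg (show ¬ ((a ≤ m ∧ (j + a ≤ m ∨ (2 * a ≤ m ∧ j + a ≤ jl))) ∧ a < j) from fun h => hg h.1), ite_self]
    rw [h1, zero_add]
    by_cases hdiag : j + m = jl + a
    · -- the diagonal top cell
      obtain ⟨hP, hM⟩ := hvTop j a hg hdiag
      rw [if_pos hdiag]
      by_cases hi : 2 * j + d ≤ 2 * jl + 1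
      · by_cases hsmall : j + a + 2 ≤ m + 2 * d
        · -- both sides alive: they cancel
          have e : vP j a = vM j a := by
            rw [hP, hM, if_pos (And.intro hi (Or.inl hsmall) : 2 * j + d ≤ 2 * jl + 1 ∧ (j + a + 2 ≤ m + 2 * d ∨ ε = 1)),
              if_pos (And.intro hi (Or.inl hsmall) : 2 * j + d ≤ 2 * jl + 1 ∧ (j + a + 2 ≤ m + 2 * d ∨ ε = -1))]
          rw [e, sub_self, mul_zero,
            if_neg (show ¬ (¬ (a ≤ m ∧ (j + a ≤ m ∨ (2 * a ≤ m ∧ j + a ≤ jl))) ∧ 2 * j + d ≤ 2 * jl + 1 ∧ ¬ (j + a + 2 ≤ m + 2 * d)) from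
              fun h => h.2.2 hsmall), mul_zero]
        · -- only the ε-side is alive
          have he : a + (j - (j + a - m + 1) / 2) = jl / 2 + a := by omega
          have eT : x ^ a * ((if j + a + 2 ≤ m + 2 * d then (1 : ℚ) else 2) * x ^ (j - (j + a - m + 1) / 2)) = 2 * x ^ (jl / 2 + a) := by
            rw [if_neg hsmall, ← he, pow_add]; ring
          rw [if_pos (show ¬ (a ≤ m ∧ (j + a ≤ m ∨ (2 * a ≤ m ∧ j + a ≤ jl))) ∧ 2 * j + d ≤ 2 * jl + 1 ∧ ¬ (j + a + 2 ≤ m + 2 * d) from ⟨hg, hi, hsmall⟩)]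
          rcases hε with rfl | rfl
          · have eP : vP j a = (if j + a + 2 ≤ m + 2 * d then (1 : ℚ) else 2) * x ^ (j - (j + a - m + 1) / 2) := by
              rw [hP, if_pos (And.intro hi (Or.inr rfl) : 2 * j + d ≤ 2 * jl + 1 ∧ (j + a + 2 ≤ m + 2 * d ∨ (1 : ℚ) = 1))]
            have eM : vM j a = 0 := by
              rw [hM, if_neg (show ¬ (2 * j + d ≤ 2 * jl + 1 ∧ (j + a + 2 ≤ m + 2 * d ∨ (1 : ℚ) = -1)) from fun h => h.2.elim hsmall (by norm_num))]
            rw [eP, eM, sub_zero, eT, one_mul]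
          · have eP : vP j a = 0 := by
              rw [hP, if_neg (show ¬ (2 * j + d ≤ 2 * jl + 1 ∧ (j + a + 2 ≤ m + 2 * d ∨ (-1 : ℚ) = 1)) from fun h => h.2.elim hsmall (by norm_num))]
            have eM : vM j a = (if j + a + 2 ≤ m + 2 * d then (1 : ℚ) else 2) * x ^ (j - (j + a - m + 1) / 2) := by
              rw [hM, if_pos (And.intro hi (Or.inr rfl) : 2 * j + d ≤ 2 * jl + 1 ∧ (j + a + 2 ≤ m + 2 * d ∨ (-1 : ℚ) = -1))]
            rw [eP, eM, zero_sub, mul_neg, eT]; ring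
      · have eP : vP j a = 0 := by rw [hP, if_neg (show ¬ (2 * j + d ≤ 2 * jl + 1 ∧ (j + a + 2 ≤ m + 2 * d ∨ ε = 1)) from fun h => hi h.1)]
        have eM : vM j a = 0 := by rw [hM, if_neg (show ¬ (2 * j + d ≤ 2 * jl + 1 ∧ (j + a + 2 ≤ m + 2 * d ∨ ε = -1)) from fun h => hi h.1)]
        rw [eP, eM, sub_self, mul_zero,
          if_neg (show ¬ (¬ (a ≤ m ∧ (j + a ≤ m ∨ (2 * a ≤ m ∧ j + a ≤ jl))) ∧ 2 * j + d ≤ 2 * jl + 1 ∧ ¬ (j + a + 2 ≤ m + 2 * d)) from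
            fun h => hi h.2.1), mul_zero]
    · -- off the diagonal and not generic: empty
      obtain ⟨hP, hM⟩ := hvOff j a hg hdiag
      rw [hP, hM, sub_self, mul_zero, if_neg hdiag]

/-- **THE COLUMN `a ≥ 1`** of the RamK difference census: the generic cells live on the parity ray `j = a + 2k`, `1 ≤ k ≤ ⌊jl∕2⌋ − a` (alive iff `2a ≤ m`), where
`x^a·(n₊ − n₋)` is `−2x^{2a+d−2}` at `k = d − 1` and `2(x−1)x^{2a+k−1}` for `k ≥ d` — a geometric block worth `2x^{⌊jl∕2⌋+a} − 2(x+1)x^{2a+d−2}` when `d + a ≤ ⌊jl∕2⌋ + 1`;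
the diagonal top cell adds `ε·2x^{⌊jl∕2⌋+a}` when `m < 2a`, `2a + d ≤ 2m + 1` (the bit `2j + d ≤ 2jl + 1`) and `2m + 2d ≤ jl + 2a + 1` (`c′ ≥ 2d − 1`). [folklore] -/
theorem col_pos_ramK (x ε : ℚ) (hε : ε = 1 ∨ ε = -1) {d jl m : ℕ} (hd : 2 ≤ d) (hm : m ≤ jl) (nP nM vP vM : ℕ → ℕ → ℚ)
    (hδ : ∀ j a, nP j a - nM j a = if a ≤ j ∧ (j - a) % 2 = 0 then
      (if a = 0 then (if 2 * d ≤ j then 2 * x ^ (j / 2) else 0)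
       else if a < j then (if j - a + 2 = 2 * d then -2 * x ^ (j - d) else if 2 * d < j - a + 2 then 2 * (x - 1) * x ^ (j - 1 - (j - a) / 2) else 0)
       else 0) else 0)
    (hvGen : ∀ j a, (a ≤ m ∧ (j + a ≤ m ∨ (2 * a ≤ m ∧ j + a ≤ jl))) → vP j a = nP j a ∧ vM j a = nM j a)
    (hvOff : ∀ j a, ¬ (a ≤ m ∧ (j + a ≤ m ∨ (2 * a ≤ m ∧ j + a ≤ jl))) → j + m ≠ jl + a → vP j a = 0 ∧ vM j a = 0)
    (hvTop : ∀ j a, ¬ (a ≤ m ∧ (j + a ≤ m ∨ (2 * a ≤ m ∧ j + a ≤ jl))) → j + m = jl + a →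
      (vP j a = if 2 * j + d ≤ 2 * jl + 1 ∧ (j + a + 2 ≤ m + 2 * d ∨ ε = 1) then (if j + a + 2 ≤ m + 2 * d then 1 else 2) * x ^ (j - (j + a - m + 1) / 2) else 0) ∧
      (vM j a = if 2 * j + d ≤ 2 * jl + 1 ∧ (j + a + 2 ≤ m + 2 * d ∨ ε = -1) then (if j + a + 2 ≤ m + 2 * d then 1 else 2) * x ^ (j - (j + a - m + 1) / 2) else 0))
    {a : ℕ} (ha : 1 ≤ a) :
    ∑ j ∈ range (jl + 1), x ^ a * (vP j a - vM j a) =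
      (if 2 * a ≤ m ∧ 2 * d + 2 * a ≤ jl + 2 then 2 * x ^ (jl / 2 + a) - 2 * (x + 1) * x ^ (2 * a + d - 2) else 0) +
      ε * (if m < 2 * a ∧ 2 * a + d ≤ 2 * m + 1 ∧ 2 * m + 2 * d ≤ jl + 2 * a + 1 then 2 * x ^ (jl / 2 + a) else 0) := by
  rw [Finset.sum_congr rfl (fun j _ => cell_pos_ramK x ε hε hm nP nM vP vM hδ hvGen hvOff hvTop ha j), Finset.sum_add_distrib]
  congr 1
  · ------------------------------------------------------------------ the generic cells on the parity ray `j = a + 2k`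
    rw [sum_range_parity_reindex (fun j => if (a ≤ m ∧ (j + a ≤ m ∨ (2 * a ≤ m ∧ j + a ≤ jl))) ∧ a < j then
        x ^ a * (if j - a + 2 = 2 * d then -2 * x ^ (j - d) else if 2 * d < j - a + 2 then 2 * (x - 1) * x ^ (j - 1 - (j - a) / 2) else 0) else 0) a jl]
    by_cases h2a : 2 * a ≤ m
    · -- the ray cells `1 ≤ k ≤ ⌊jl∕2⌋ − a`: `k = d − 1` and the window `d ≤ k`
      have hk : ∀ k ∈ range ((jl + 2 - a) / 2),
          (if (a ≤ m ∧ (a + 2 * k + a ≤ m ∨ (2 * a ≤ m ∧ a + 2 * k + a ≤ jl))) ∧ a < a + 2 * k then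
            x ^ a * (if a + 2 * k - a + 2 = 2 * d then -2 * x ^ (a + 2 * k - d)
              else if 2 * d < a + 2 * k - a + 2 then 2 * (x - 1) * x ^ (a + 2 * k - 1 - (a + 2 * k - a) / 2) else 0) else 0) =
          (if k = d - 1 then (if d + a ≤ jl / 2 + 1 then -2 * x ^ (2 * a + d - 2) else 0) else 0) +
          (if d ≤ k ∧ k < d + (jl / 2 + 1 - a - d) then 2 * (x - 1) * x ^ (2 * a + k - 1) else 0) := by
        intro k _
        rw [Nat.add_sub_cancel_left]
        by_cases hK : 1 ≤ k ∧ k ≤ jl / 2 - a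
        · rw [if_pos (show (a ≤ m ∧ (a + 2 * k + a ≤ m ∨ (2 * a ≤ m ∧ a + 2 * k + a ≤ jl))) ∧ a < a + 2 * k by omega)]
          by_cases hk1 : k = d - 1
          · rw [if_pos (show 2 * k + 2 = 2 * d by omega), if_pos hk1, if_pos (show d + a ≤ jl / 2 + 1 by omega), if_neg (by omega), add_zero,
              show a + 2 * k - d = a + d - 2 by omega, ← mul_assoc, mul_comm (x ^ a), mul_assoc, ← pow_add, show a + (a + d - 2) = 2 * a + d - 2 by omega]
          · rw [if_neg (show ¬ 2 * k + 2 = 2 * d by omega), if_neg hk1, zero_add]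
            by_cases hkd : d ≤ k
            · rw [if_pos (show 2 * d < 2 * k + 2 by omega), if_pos (show d ≤ k ∧ k < d + (jl / 2 + 1 - a - d) by omega),
                show a + 2 * k - 1 - 2 * k / 2 = a + k - 1 by omega, ← mul_assoc, mul_comm (x ^ a), mul_assoc, ← pow_add,
                show a + (a + k - 1) = 2 * a + k - 1 by omega]
            · rw [if_neg (show ¬ 2 * d < 2 * k + 2 by omega), mul_zero, if_neg (show ¬ (d ≤ k ∧ k < d + (jl / 2 + 1 - a - d)) by omega)]
        · rw [if_neg (show ¬ ((a ≤ m ∧ (a + 2 * k + a ≤ m ∨ (2 * a ≤ m ∧ a + 2 * k + a ≤ jl))) ∧ a < a + 2 * k) by omega),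
            if_neg (show ¬ (d ≤ k ∧ k < d + (jl / 2 + 1 - a - d)) by omega), add_zero]
          by_cases hk1 : k = d - 1
          · rw [if_pos hk1, if_neg (show ¬ d + a ≤ jl / 2 + 1 by omega)]
          · rw [if_neg hk1]
      rw [Finset.sum_congr rfl hk, Finset.sum_add_distrib, Finset.sum_ite_eq' (range ((jl + 2 - a) / 2))]
      by_cases hwin : d + a ≤ jl / 2 + 1
      · rw [if_pos (Finset.mem_range.2 (show d - 1 < (jl + 2 - a) / 2 by omega)), if_pos hwin, if_pos (show 2 * a ≤ m ∧ 2 * d + 2 * a ≤ jl + 2 by omega),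
          sum_range_window_reindex (fun k => 2 * (x - 1) * x ^ (2 * a + k - 1)) (show d + (jl / 2 + 1 - a - d) ≤ (jl + 2 - a) / 2 by omega)]
        have hw : ∑ i ∈ range (jl / 2 + 1 - a - d), 2 * (x - 1) * x ^ (2 * a + (d + i) - 1) = 2 * x ^ (2 * a + d - 1) * ((x - 1) * ∑ i ∈ range (jl / 2 + 1 - a - d), x ^ i) := by
          rw [Finset.mul_sum, Finset.mul_sum]
          refine Finset.sum_congr rfl fun i _ => ?_
          rw [show 2 * a + (d + i) - 1 = (2 * a + d - 1) + i by omega, pow_add]; ring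
        rw [hw, geom_sum_mul', ← sub_eq_zero]
        have e1 : x ^ (jl / 2 + a) = x ^ (2 * a + d - 1) * x ^ (jl / 2 + 1 - a - d) := by rw [← pow_add]; congr 1; omega
        have e2 : x ^ (2 * a + d - 1) = x ^ (2 * a + d - 2) * x := by rw [← pow_succ]; congr 1; omega
        rw [e1, e2]; ring
      · rw [if_neg hwin, ite_self, zero_add, if_neg (show ¬ (2 * a ≤ m ∧ 2 * d + 2 * a ≤ jl + 2) by omega)]
        refine Finset.sum_eq_zero fun k _ => ?_
        rw [if_neg (show ¬ (d ≤ k ∧ k < d + (jl / 2 + 1 - a - d)) by omega)]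
    · -- `2a > m`: no generic cell above `a` on this column
      rw [if_neg (show ¬ (2 * a ≤ m ∧ 2 * d + 2 * a ≤ jl + 2) from fun h => h2a h.1)]
      refine Finset.sum_eq_zero fun k _ => ?_
      rw [if_neg (show ¬ ((a ≤ m ∧ (a + 2 * k + a ≤ m ∨ (2 * a ≤ m ∧ a + 2 * k + a ≤ jl))) ∧ a < a + 2 * k) by omega)]
  · ------------------------------------------------------------------ the diagonal top cell `j = jl + a − m`
    have hiff : ∀ j ∈ range (jl + 1),
        (if j + m = jl + a then ε * (if ¬ (a ≤ m ∧ (j + a ≤ m ∨ (2 * a ≤ m ∧ j + a ≤ jl))) ∧ 2 * j + d ≤ 2 * jl + 1 ∧ ¬ (j + a + 2 ≤ m + 2 * d) then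
          2 * x ^ (jl / 2 + a) else 0) else 0) =
        (if j = jl + a - m then ε * (if ¬ (a ≤ m ∧ (j + a ≤ m ∨ (2 * a ≤ m ∧ j + a ≤ jl))) ∧ 2 * j + d ≤ 2 * jl + 1 ∧ ¬ (j + a + 2 ≤ m + 2 * d) then
          2 * x ^ (jl / 2 + a) else 0) else 0) := by
      intro j _
      by_cases h : j + m = jl + a
      · rw [if_pos h, if_pos (show j = jl + a - m by omega)]
      · rw [if_neg h, if_neg (show j ≠ jl + a - m by omega)]
    rw [Finset.sum_congr rfl hiff, Finset.sum_ite_eq' (range (jl + 1))]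
    by_cases htop : m < 2 * a ∧ 2 * a + d ≤ 2 * m + 1 ∧ 2 * m + 2 * d ≤ jl + 2 * a + 1
    · rw [if_pos htop, if_pos (Finset.mem_range.2 (show jl + a - m < jl + 1 by omega))]
      congr 1
      rw [if_pos]
      refine ⟨fun h => ?_, ?_, fun h => ?_⟩ <;> omega
    · rw [if_neg htop, mul_zero]
      by_cases hmem : jl + a - m ∈ range (jl + 1)
      · rw [if_pos hmem, if_neg, mul_zero]
        rw [Finset.mem_range] at hmem
        intro h
        apply htop
        obtain ⟨h1, h2, h3⟩ := h
        refine ⟨?_, ?_, ?_⟩ <;> omega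
      · rw [if_neg hmem]

/-- `(x − 1)·Σ_{i<n} (2x^{J+1}·x^i − 2(x+1)x^d·x^{2i}) = 2x^{J+1}(x^n − 1) − 2x^d(x^{2n} − 1)` — the generic columns `1 ≤ a ≤ n` telescope. [folklore] -/
theorem genBlock_mul (x : ℚ) (J d n : ℕ) :
    (x - 1) * ∑ i ∈ range n, (2 * x ^ (J + 1) * x ^ i - 2 * (x + 1) * x ^ d * x ^ (2 * i)) = 2 * x ^ (J + 1) * (x ^ n - 1) - 2 * x ^ d * (x ^ (2 * n) - 1) := by
  have h1 := geom_sum_mul' x n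
  have h2 := geom_sum_two_mul x n
  rw [Finset.sum_sub_distrib, ← Finset.mul_sum, ← Finset.mul_sum]
  linear_combination (2 * x ^ (J + 1)) * h1 - (2 * x ^ d) * h2

/-- `(x − 1)·Σ_{i<n} 2x^E·x^i = 2x^E(x^n − 1)` — the one-sided diagonal top cells form one geometric block. [folklore] -/
theorem topBlock_mul (x : ℚ) (E n : ℕ) : (x - 1) * ∑ i ∈ range n, 2 * x ^ E * x ^ i = 2 * x ^ E * (x ^ n - 1) := by
  have h1 := geom_sum_mul' x n
  rw [← Finset.mul_sum]
  linear_combination (2 * x ^ E) * h1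

end Summit.HodgeConjecture.HodgeConjecture.Cruxes.H413.F0P3cDyRamToricCensusSumRamKParts
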